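/-!
# Bit-planes for the 6-vertex gadget, 0: the definitions and the kernel table (p5, gen 13)

NO IMPORTS ON PURPOSE: the kernel evaluation of `table` (all `2^24` states at once, one GMP
operation per gate on `2^24`-bit literals, ≈ 8 s) trips the kernel's memory guard in any file that
imports Mathlib or the tree; the lemma modules import this one.  The definitions are the ones of the
semantics modules (restated there with `ℕ`).
-/

namespace PercRepro

namespace Plane6

/-- The number of states. -/
def NS : Nat := 2 ^ 24

/-- The all-ones plane. -/
def ones : Nat := 2 ^ NS - 1

/-- Plane negation. -/
def notP (x : Nat) : Nat := x ^^^ ones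

/-- The input plane of bit `i` at width `2^n` (doubling recursion): bit `s < 2^n` is `s.testBit i`. -/
def inP (i : Nat) : Nat → Nat
  | 0 => 0
  | n + 1 => inP i n ||| ((if i = n then 2 ^ (2 ^ n) - 1 else inP i n) <<< (2 ^ n))

/-- The input plane of bit `i` of the state. -/
def I (i : Nat) : Nat := inP i 24

/-- The class index of the pair `(u, v)`; mark–mark pairs and loops have none. -/
def cls (u v : Nat) : Option Nat :=
  match u, v with
  | 0, 3 => some 0 | 3, 0 => some 0 | 0, 4 => some 1 | 4, 0 => some 1 | 0, 5 => some 2 | 5, 0 => some 2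
  | 1, 3 => some 3 | 3, 1 => some 3 | 1, 4 => some 4 | 4, 1 => some 4 | 1, 5 => some 5 | 5, 1 => some 5
  | 2, 3 => some 6 | 3, 2 => some 6 | 2, 4 => some 7 | 4, 2 => some 7 | 2, 5 => some 8 | 5, 2 => some 8
  | 3, 4 => some 9 | 4, 3 => some 9 | 3, 5 => some 10 | 5, 3 => some 10 | 4, 5 => some 11 | 5, 4 => some 11
  | _, _ => none

/-- The open bit of the pair `(u, v)` in the state `s`. -/
def oBit (s u v : Nat) : Bool := match cls u v with | some c => s.testBit c | none => false

/-- The closed bit of the pair `(u, v)` in the state `s`. -/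
def cBit (s u v : Nat) : Bool := match cls u v with | some c => s.testBit (12 + c) | none => false

/-- Plane-valued rows. -/
abbrev PRows := Nat → Nat → Nat

/-- The open rows of all states. -/
def Orows : PRows := fun u v => match cls u v with | some i => I i | none => 0

/-- The closed rows of all states. -/
def Crows : PRows := fun u v => match cls u v with | some i => I (12 + i) | none => 0

/-- A vertex set as six planes. -/
structure V6 where
  v0 : Nat
  v1 : Nat
  v2 : Nat
  v3 : Nat
  v4 : Nat
  v5 : Nat

/-- The plane of vertex `w`. -/
def V6.get (S : V6) : Nat → Nat
  | 0 => S.v0 | 1 => S.v1 | 2 => S.v2 | 3 => S.v3 | 4 => S.v4 | 5 => S.v5 | _ => 0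

/-- The vertex set with the plane `f w` at `w`. -/
def V6.ofFn (f : Nat → Nat) : V6 := ⟨f 0, f 1, f 2, f 3, f 4, f 5⟩

/-- Transposed `nbr`. -/
def nbrP : Nat → PRows → V6 → V6
  | 0, _, _ => V6.ofFn fun _ => 0
  | n + 1, R, S => let rest := nbrP n R S; V6.ofFn fun w => (S.get n &&& R n w) ||| rest.get w

/-- Transposed `step`. -/
def stepP (n : Nat) (R : PRows) (S : V6) : V6 :=
  let N := nbrP n R S
  V6.ofFn fun w => S.get w ||| N.get w

/-- Transposed iteration of `step`. -/
def iterP (n : Nat) (R : PRows) : Nat → V6 → V6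
  | 0, S => S
  | k + 1, S => iterP n R k (stepP n R S)

/-- The singleton vertex set. -/
def unit (i : Nat) : V6 := V6.ofFn fun w => if w = i then ones else 0

/-- Transposed `reach`. -/
def reachP (n : Nat) (R : PRows) (i : Nat) : V6 := iterP n R n (unit i)

/-- Transposed `reachB`. -/
def reachBP (n : Nat) (R : PRows) (i j : Nat) : Nat := (reachP n R i).get j

/-- Transposed `closureRows`. -/
def closureRowsP (n : Nat) (O : PRows) : PRows := fun i j => reachBP n O i j

/-- Transposed `hBit`. -/
def hBitP (O C Ocl : PRows) (M : V6) (i j : Nat) : Nat :=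
  if i = j then 0 else
    ((M.get i &&& M.get j &&& C i j) |||
     ((M.get i ^^^ M.get j) &&& (O i j ||| C i j)) |||
     (notP (M.get i) &&& notP (M.get j) &&& Ocl i j))

/-- Transposed `hRows`. -/
def hRowsP (n : Nat) (O C Ocl : PRows) (M : V6) : PRows :=
  fun i j => if i < n ∧ j < n then hBitP O C Ocl M i j else 0

/-- Transposed `avoid`. -/
def avoidP (n : Nat) (H : PRows) (X : V6) : PRows :=
  fun i j => if i < n ∧ j < n then notP (X.get i) &&& notP (X.get j) &&& H i j else 0

/-- Transposed `botB`. -/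
def botP (n : Nat) (O : PRows) : Nat :=
  notP (reachBP n O 0 1) &&& notP (reachBP n O 0 2) &&& notP (reachBP n O 1 2)

/-- Transposed `hOf`. -/
def hOfP (n : Nat) (O C : PRows) : PRows := hRowsP n O C (closureRowsP n O) (reachP n O 2)

/-- Transposed `o1B`. -/
def o1P (n : Nat) (O C : PRows) : Nat := reachBP n (avoidP n (hOfP n O C) (reachP n O 1)) 2 0

/-- Transposed `o2B`. -/
def o2P (n : Nat) (O C : PRows) : Nat := reachBP n (avoidP n (hOfP n O C) (reachP n O 0)) 2 1

/-- Transposed `badB`. -/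
def badP (n : Nat) (O C : PRows) : Nat := reachBP n (avoidP n (hOfP n O C) (V6.ofFn fun _ => 0)) 0 1

/-- `bot` of every state. -/
def bot : Nat := botP 6 Orows

/-- `o1` of every state. -/
def o1 : Nat := o1P 6 Orows Crows

/-- `o2` of every state. -/
def o2 : Nat := o2P 6 Orows Crows

/-- `BAD` of every state. -/
def BAD : Nat := badP 6 Orows Crows

/-- Adding a carry plane to a number (LSB-first list of planes). -/
def addC : List Nat → Nat → List Nat
  | [], c => [c]
  | b :: bs, c => (b ^^^ c) :: addC bs (b &&& c)

/-- Ripple-carry addition of two numbers. -/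
def addP : List Nat → List Nat → Nat → List Nat
  | [], bs, c => addC bs c
  | a :: as, bs, c =>
      match bs with
      | [] => (a ^^^ c) :: addP as [] (a &&& c)
      | b :: bs' =>
          let t := a ^^^ b
          (t ^^^ c) :: addP as bs' ((a &&& b) ||| (t &&& c))

/-- The open positions `(1, 0)` of class `i`. -/
def openMask (i : Nat) : Nat := I i &&& notP (I (12 + i))

/-- The offset from the open position `(1, 0)` of class `i` to its closed position `(0, 1)`. -/
def off (i : Nat) : Nat := 2 ^ (12 + i) - 2 ^ i

/-- Level `i`: add the value at the closed position of class `i` into its open position. -/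
def level (i : Nat) (x : List Nat) : List Nat :=
  addP x (x.map fun p => (p >>> off i) &&& openMask i) 0

/-- The levels `k − 1, …, 0`. -/
def levels : Nat → List Nat → List Nat
  | 0, x => x
  | i + 1, x => levels i (level i x)

/-- `l ∨ (some bit of `bs`)`. -/
def anyP : List Nat → Nat → Nat
  | [], l => l
  | b :: bs, l => anyP bs (b ||| l)

/-- `a < b` bit-sliced, with the accumulator `l` (the verdict of the lower bits). -/
def ltP : List Nat → List Nat → Nat → Nat
  | [], bs, l => anyP bs l
  | a :: as, bs, l =>
      match bs with
      | [] => ltP as [] (notP a &&& l)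
      | b :: bs' => ltP as bs' ((notP a &&& b) ||| (notP (a ^^^ b) &&& l))

/-- The number encoded at the state `s` by the planes `x` (LSB first). -/
def valAt : List Nat → Nat → Nat
  | [], _ => 0
  | p :: ps, s => (p.testBit s).toNat + 2 * valAt ps s

/-- The valid positions: no class in the garbage state `(0, 1)`. -/
def valid : Nat := (List.range 12).foldl (fun acc i => acc &&& (I i ||| notP (I (12 + i)))) ones

/-- Class `i` of the state `s` is open `(1, 0)`. -/
def isOpenCls (i s : Nat) : Bool := s.testBit i && !s.testBit (12 + i)

/-- The closed position of class `i` from its open position. -/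
def flip (i s : Nat) : Nat := off i + s

/-- **THE TABLE**: every cell coefficient of `(★)` on the 6-vertex gadget is nonnegative — one kernel
evaluation of the bit-sliced circuit and the twelve shift-and-add levels, compared cell by cell. -/
theorem table :
    ltP (levels 12 [bot &&& (o1 ^^^ o2), bot &&& (o1 &&& o2)]) (levels 12 [bot &&& BAD]) 0 &&& valid = 0 := by
  decide +kernel

end Plane6

end PercRepro
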